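import Literature.AlgebraicGeometry.Resolution.PointBlowupMohBoundPrimePower
import HarnessLib

/-!
# After a jump at order `pᵉ`: no second jump whenever the new initial form meets the lowest layer

Topic: `Literature/AlgebraicGeometry/Resolution`. Companion (cell `pub-hironaka`, unit
`b2b-hironaka-cp4`, DIM-4 CENSUS gen 14) of `PointBlowupMohBoundPrimePower.lean` (Moh's one-step
bound at order `q = pᵉ` for every `e`, with the Hasse probe `shade_step_le_of_choose_ne_zero` and
the necessary conditions `necessary_of_shadeIncreases_pow`) and of the `e = 1` theorem
`PointBlowupMohBound.not_shadeIncreases_step_of_shadeIncreases` ("no two consecutive increases at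
order `p`, in every dimension").

At order `q = pᵉ` with `e ≥ 2` the `e = 1` argument does not transfer verbatim: it rests on the
fact that after an increase the probe monomial is INITIAL in the new residual polynomial `F′`
(`|E| = |r′| + shade + 1 = ord₀ F′`), which at `e ≥ 2` holds only when the jump equals the slack.
What DOES transfer, and is proved here for every `e`, every field of characteristic `p` and every
number of variables:

* `PointBlowup.not_shadeIncreases_step_of_mem_lowestLayer` — if the shade increases at the point
  `b` of the `y_j`-chart (state `s = (F, r)` cleaned, `yʳ ∣ F`, `ord₀ F = o ≥ q`) and the new
  residual polynomial `F′` has an INITIAL monomial `y^E` (`|E| = ord₀ F′`) in the LOWEST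
  `y_j`-layer (`E_j = o − q`), then the next point blow-up — any chart `j′`, any point `b′` of its
  exceptional divisor at which the order is still `≥ q` — does NOT increase the shade again.
  Mechanism (the `e = 1` proof with `q` for `p`): `y^E` comes from an initial monomial `y^d` of
  `F` (`E_j = |d| − q` forces `|d| = o`), so `E_i = d_i ≡ 0 (mod q)` at every untranslated
  `i ≠ j` (`necessary_of_shadeIncreases_pow` (ii) at the first step) and `E_j = o − q ≡ 0`; a second
  increase forces `q ∣ ord₀ F′ = |E|` (Probe 1), hence `q ∣ Σ_{b_i ≠ 0} E_i`; `E` is not a `q`-th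
  power, so some translated `i₂` has `q ∤ E_{i₂}`, and then a second translated `i₃ ≠ i₂` has
  `q ∤ E_{i₃}`; both are NON-exceptional in the new state (`r′ = 0` at translated indices), and one
  of them differs from `j′`: `shade_step_le_of_choose_ne_zero` (with `k = v_p` of that exponent)
  forbids the second increase.
* Consequently (`PointBlowup.consecutive_shadeIncreases_pow`) two consecutive increases at order
  `pᵉ` force EVERY initial monomial of the intermediate residual polynomial to lie in a higher
  `y_j`-layer (`E_j > o − q`), i.e. to come from NON-initial monomials of `F`; in particular the
  first jump is then strictly smaller than the slack of every Hasse probe. This residual case is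
  EXCLUDED in the sequel `PointBlowupNoConsecutiveJumps.lean`
  (`PointBlowup.not_shadeIncreases_step_of_shadeIncreases_pow`: no two consecutive increases at
  order `pᵉ`, every `e`, every dimension): after an increase the degrees of the lowest `y_j`-layer
  and a second-jump order `ord₀ F′` are all divisible by `p^κ`, `κ` the least Hasse digit seen at a
  lost exceptional index, which is incompatible with the probe's slack `min(p^κ, r_{i₀})`. Nothing
  about it is asserted in THIS file. (The cell's question Q37.7 of `OBSTRUCTIONS-DIM4.md` §37.7 as
  literally phrased — "`q ∤ ord₀ F′` after every increase at `e ≥ 2`" — is false: `q ∣ ord₀ F′`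
  occurs after Frobenius twists of `e = 1` jumps, e.g. `p = 2`, `q = 4`,
  `F = x²y²z²(x² + y² + z²)`, `r = (2,2,2)`, `x`-chart, point `(y, z) = (1, 1)`: `ord₀ F′ = 8`, shade
  `2 → 4` (`OBSTRUCTIONS-DIM4.md` §39.3, engine computation); the sampled evidence recorded by the
  cell is §37.7–§37.8 (≈ 2.2·10⁵ increases at `e = 2`, none with `q ∣ ord₀ F′`) and §37.9–§37.10
  (0 consecutive increases in 3 647 081 second steps at `e ∈ {2, 3}`).)

Printed context: [Moh1987] p. 972 (cases (1)–(2) after the Statement, `e` arbitrary, along a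
valuation); [Hauser2010] §F p. 16 ("in the next blowup the shade has to drop at least by 1 (if
`e = 1`)"); [HauserPerlega2019] §3 (Moh's claim false for `e ≥ 3`, "known to be valid for `e = 1`").
The statement proved here is derived by the cell (not printed); census value only. [folklore]
-/

noncomputable section

open MvPolynomial Finset

open scoped BigOperators

namespace Literature.AlgebraicGeometry.Resolution

open Literature.AlgebraicGeometry.Resolution.Hauser2010
open Literature.Barriers.ResolutionOfSingularities
open Literature.AlgebraicGeometry.Resolution.WeightedBlowup

namespace PointBlowup

section NoDouble

variable {σ : Type*} {K : Type*} [Field K] [Fintype σ] [DecidableEq σ] [DecidableEq K]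
variable (p : ℕ) [hp : Fact p.Prime] [CharP K p]

/-- **No second increase when the new initial form meets the lowest layer** (order `q = pᵉ`,
every `e`, every dimension): after an increase at the point `b` of the `y_j`-chart, if the new
residual polynomial has an initial monomial `y^E` with `E_j = ord₀ F − q`, the next point blow-up
(any chart `j′`, any point `b′` with the order still `≥ q`) does not increase the shade. For
`e = 1` the hypothesis is automatic (`PointBlowupMohBound.exists_nonexceptional_of_shadeIncreases`)
and the statement is `not_shadeIncreases_step_of_shadeIncreases`. [folklore] -/
theorem not_shadeIncreases_step_of_mem_lowestLayer {e : ℕ} (j : σ) (b : σ → K) (hbj : b j = 0)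
    (s : State σ K) (hclean : deletePthPowers (p ^ e) s.F = s.F) {o : ℕ} (ho : ordZero s.F = o)
    (hqo : p ^ e ≤ o) (hr : ∀ d ∈ s.F.support, s.r ≤ d) (hinc : ShadeIncreases (p ^ e) j b s)
    {o₁ : ℕ} (ho₁ : ordZero (step (p ^ e) j b s).F = o₁) (hqo₁ : p ^ e ≤ o₁)
    {E : σ →₀ ℕ} (hE : E ∈ (step (p ^ e) j b s).F.support) (hEdeg : E.degree = o₁)
    (hEj : E j = o - p ^ e) (j' : σ) (b' : σ → K) (hbj' : b' j' = 0) :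
    ¬ ShadeIncreases (p ^ e) j' b' (step (p ^ e) j b s) := by
  intro hinc'
  set q : ℕ := p ^ e with hqdef
  have hdeg := le_degree_of_ordZero_eq s ho
  obtain ⟨hqdvd, hfix, -⟩ := necessary_of_shadeIncreases_pow p j b hbj s hclean ho hqo hr hinc
  have hclean₁ := deletePthPowers_step q j b s
  have hr₁ := newMult_le_of_mem_support_step q j b hbj s ho hr
  obtain ⟨hqdvd₁, -, -⟩ :=
    necessary_of_shadeIncreases_pow p j' b' hbj' (step q j b s) hclean₁ ho₁ hqo₁ hr₁ hinc'
  -- the source monomial `y^d` of `y^E`: initial in `F`, with `E_i = d_i` at untranslated `i`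
  have hEG : coeff E (pointTransform q j b s) ≠ 0 := by
    have h := MvPolynomial.mem_support_iff.mp hE
    change coeff E (deletePthPowers q (pointTransform q j b s)) ≠ 0 at h
    rw [coeff_deletePthPowers] at h
    split_ifs at h with hP
    · exact (h rfl).elim
    · exact h
  have hEnot : ¬ IsPthPowerExponent q E := by
    have h := MvPolynomial.mem_support_iff.mp hE
    change coeff E (deletePthPowers q (pointTransform q j b s)) ≠ 0 at h
    rw [coeff_deletePthPowers] at h
    split_ifs at h with hP
    · exact (h rfl).elim
    · exact hP
  rw [pointTransform_eq_sum, coeff_sum] at hEG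
  obtain ⟨d, hd, hne⟩ := Finset.exists_ne_zero_of_sum_ne_zero hEG
  have hdo : d.degree = o := by
    have h1 : E j = chartExponent q j d j := apply_eq_of_coeff_translate_monomial_ne_zero b hbj hne
    rw [chartExponent_apply, if_pos rfl, hEj] at h1
    have h2 := hdeg d hd
    omega
  have hEfix : ∀ i, i ≠ j → b i = 0 → E i = d i := by
    intro i hij hbi
    rw [apply_eq_of_coeff_translate_monomial_ne_zero b hbi hne, chartExponent_apply, if_neg hij]
  -- exponents at `j` and at the untranslated indices are divisible by `q`
  have hEjdvd : q ∣ E j := by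
    rw [hEj]
    have : o = (o - q) + q := by omega
    rw [this] at hqdvd
    exact (Nat.dvd_add_left (dvd_refl q)).mp hqdvd
  have hEZ : ∀ i, i ≠ j → b i = 0 → q ∣ E i := by
    intro i hij hbi
    rw [hEfix i hij hbi]
    exact hfix i hij (Or.inl hbi) d hd hdo
  -- a translated index carries a non-`q`-divisible exponent …
  obtain ⟨i₂, hbi₂, hEi₂⟩ : ∃ i₂, b i₂ ≠ 0 ∧ ¬ q ∣ E i₂ := by
    by_contra hc
    push Not at hc
    apply hEnot
    rw [isPthPowerExponent_iff]
    intro i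
    by_cases hij : i = j
    · rw [hij]; exact hEjdvd
    · by_cases hbi : b i = 0
      · exact hEZ i hij hbi
      · exact hc i hbi
  -- … and, since `q ∣ |E|`, so does a second translated index
  obtain ⟨i₃, hbi₃, hi₃, hEi₃⟩ : ∃ i₃, b i₃ ≠ 0 ∧ i₃ ≠ i₂ ∧ ¬ q ∣ E i₃ := by
    by_contra hc
    push Not at hc
    apply hEi₂
    have hsum : q ∣ ∑ i ∈ univ.erase i₂, E i := by
      refine Finset.dvd_sum fun i hi => ?_
      have hii₂ : i ≠ i₂ := Finset.ne_of_mem_erase hi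
      by_cases hbi : b i = 0
      · by_cases hij : i = j
        · rw [hij]; exact hEjdvd
        · exact hEZ i hij hbi
      · exact hc i hbi hii₂
    have htot : q ∣ E.degree := hEdeg ▸ hqdvd₁
    rw [degree_eq_add_sum_erase i₂ E] at htot
    exact (Nat.dvd_add_left hsum).mp htot
  -- both are non-exceptional in the new state; one of them is not the second chart
  have hr1 : ∀ i, b i ≠ 0 → (step q j b s).r i = 0 := by
    intro i hbi
    show newMult q j b s i = 0
    rw [newMult_eq q j b hbj s ho, Finsupp.filter_apply, if_neg hbi]
  -- pick the index different from `j'`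
  have key : ∀ i, i ≠ j' → b i ≠ 0 → ¬ q ∣ E i → False := by
    intro i hij' hbi hEi
    obtain ⟨k, hk, hk0⟩ := exists_natCast_choose_prime_pow_ne_zero p K hEi
    have := shade_step_le_of_choose_ne_zero p j' b' hbj' (step q j b s) ho₁ hqo₁ hr₁ hij'
      (Or.inr (hr1 i hbi)) hk hE hEdeg hk0
    exact absurd this (not_le.mpr hinc')
  by_cases h₂ : i₂ = j'
  · exact key i₃ (fun h => hi₃ (h.trans h₂.symm)) hbi₃ hEi₃
  · exact key i₂ h₂ hbi₂ hEi₂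

/-- **Two consecutive increases at order `pᵉ` avoid the lowest layer** (every `e`, every
dimension): if the shade increases at `(j, b)` and again at the next point blow-up `(j′, b′)`
(order still `≥ q`), then every initial monomial `y^E` of the intermediate residual polynomial
lies in a higher `y_j`-layer: `E_j > ord₀ F − q` (it comes from a non-initial monomial of `F`).
[folklore] -/
theorem consecutive_shadeIncreases_pow {e : ℕ} (j : σ) (b : σ → K) (hbj : b j = 0)
    (s : State σ K) (hclean : deletePthPowers (p ^ e) s.F = s.F) {o : ℕ} (ho : ordZero s.F = o)
    (hqo : p ^ e ≤ o) (hr : ∀ d ∈ s.F.support, s.r ≤ d) (hinc : ShadeIncreases (p ^ e) j b s)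
    {o₁ : ℕ} (ho₁ : ordZero (step (p ^ e) j b s).F = o₁) (hqo₁ : p ^ e ≤ o₁)
    (j' : σ) (b' : σ → K) (hbj' : b' j' = 0)
    (hinc' : ShadeIncreases (p ^ e) j' b' (step (p ^ e) j b s)) :
    ∀ E ∈ (step (p ^ e) j b s).F.support, E.degree = o₁ → o - p ^ e < E j := by
  intro E hE hEdeg
  -- every monomial of the new residual polynomial has `E_j ≥ o − q`
  have hdeg := le_degree_of_ordZero_eq s ho
  have hEG : coeff E (pointTransform (p ^ e) j b s) ≠ 0 := by
    have h := MvPolynomial.mem_support_iff.mp hE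
    change coeff E (deletePthPowers (p ^ e) (pointTransform (p ^ e) j b s)) ≠ 0 at h
    rw [coeff_deletePthPowers] at h
    split_ifs at h with hP
    · exact (h rfl).elim
    · exact h
  rw [pointTransform_eq_sum, coeff_sum] at hEG
  obtain ⟨d, hd, hne⟩ := Finset.exists_ne_zero_of_sum_ne_zero hEG
  have h1 : E j = chartExponent (p ^ e) j d j := apply_eq_of_coeff_translate_monomial_ne_zero b hbj hne
  rw [chartExponent_apply, if_pos rfl] at h1
  have h2 := hdeg d hd
  rcases Nat.lt_or_ge (o - p ^ e) (E j) with hlt | hle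
  · exact hlt
  · exfalso
    have hEj : E j = o - p ^ e := by omega
    exact not_shadeIncreases_step_of_mem_lowestLayer p j b hbj s hclean ho hqo hr hinc ho₁ hqo₁ hE
      hEdeg hEj j' b' hbj' hinc'

end NoDouble

end PointBlowup

end Literature.AlgebraicGeometry.Resolution

end
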